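import Literature.NumberTheory.LFunctions.DirichletLogDerivSegments
import Literature.NumberTheory.LFunctions.ClassicalPsiErrorTerm
import Literature.Analysis.Complex.VerticalLineShift
import Mathlib.Analysis.SpecialFunctions.JapaneseBracket
import HarnessLib

/-!
# The Riesz mean of `Λ_{q,a}` as a line integral on `Re s = σ' > σ₁` when the `L(s, χ)` mod `q`
# have no zeros in `σ > σ₁`

Topic `Literature/NumberTheory/LFunctions`. Everything in this file is PROVED (theorems only).

Let `Λ_{q,a}(n) = φ(q)Λ(n)𝟙_{n ≡ a (q)}` (`(a, q) = 1`) and `F_{q,a} = φ(q) ·` (Mathlib's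
`ArithmeticFunction.vonMangoldt.LFunctionResidueClassAux a`), so that
`∑ Λ_{q,a}(n)n^{-s} = 1/(s − 1) + F_{q,a}(s)` on `σ > 1` (MV (11.22)). Suppose that every zero of
every `L(s, χ)`, `χ` mod `q`, in the strip `0 < σ < 1` has `σ ≤ σ₁`, where `1/2 ≤ σ₁`
(`Literature.NumberTheory.LFunctions.ResidueRiesz.ZerosRealPartLE q σ₁`; this is literally the
hypothesis `Literature.Barriers.Parity.ZerosRealPartLE` of the barrier catalogue, restated here so
that the number-theory files need not import the catalogue). Then `F_{q,a}` is holomorphic on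
`σ > σ₁`, and by the local partial fraction of the tree
(`Literature.NumberTheory.LFunctions.DirichletSegments.exists_package`) it satisfies
`|F_{q,a}(σ + it)| ≤ C φ(q)(1 + 1/ε)(log q + log(|t| + 4))` for `σ₁ + ε ≤ σ ≤ 2`
(`norm_Faux_le`). Consequently the absolutely convergent Perron formula of order one
(`Literature.NumberTheory.LFunctions.RieszMean.sum_mul_sub_eq_integral_LSeries_real`, MV (5.19)) may
be shifted from `Re s = 2` to any line `Re s = σ'`, `σ₁ < σ' ≤ 2`
(`Literature.Analysis.Complex.integral_vertical_eq_of_differentiableOn`):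

* `Literature.NumberTheory.LFunctions.ResidueRiesz.rieszMean_sub_eq_integral` — for `x ≥ 1`,
  `ψ₁(x; Λ_{q,a}) − (x − 1)²/2 = (1/2π) ∫ x^{1+s} F_{q,a}(s) dt/(s(s+1))`, `s = σ' + it`, with the
  integrand absolutely integrable (`integrable_Phi`), where `ψ₁(x; Λ) = ∑_{n ≤ x} Λ(n)(x − n)` is the
  tree's `ClassicalPsiData.rieszMean`.

This is the conditional input ("quasi-GRH mod `q` ⇒ explicit control of `ψ₁(x; q, a)`") of the
averaged Goldbach problem in progressions (Bhowmik–Halupczok–Matsumoto–Suzuki 2019, §3, Step 1,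
where the truncated explicit formula is used instead).

## References

* H. L. Montgomery, R. C. Vaughan, *Multiplicative Number Theory I. Classical Theory*, CUP 2007,
  §5.1 (5.19), (11.22), Lemma 12.6 (`MontgomeryVaughan2007`).
* G. Bhowmik, K. Halupczok, K. Matsumoto, Y. Suzuki, *Goldbach representations in arithmetic
  progressions and zeros of Dirichlet L-functions*, Mathematika 65 (2019), 57–97, §3
  (`BhowmikHalupczokMatsumotoSuzuki2019`).
-/

noncomputable section

open Complex Set Metric Filter Topology Real MeasureTheory
open ArithmeticFunction.vonMangoldt DirichletCharacter

namespace Literature.NumberTheory.LFunctions.ResidueRiesz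

variable {q : ℕ} [NeZero q]

/-! ### `Λ_{q,a}`, `F_{q,a}` and the Dirichlet series identity (MV (11.22)) -/

/-- `Λ_{q,a}(n) = φ(q) Λ(n) 𝟙_{n ≡ a (q)}` (Mathlib's `residueClass a`, scaled by `φ(q)`).
[cite: MontgomeryVaughan2007, §11.3 eq. (11.22)] -/
def Lam (a : ZMod q) (n : ℕ) : ℝ := (q.totient : ℝ) * residueClass a n

/-- `F_{q,a}(s) = φ(q) · LFunctionResidueClassAux a s = −L₁'/L₁(s, χ₀) − ∑_{χ ≠ χ₀} χ̄(a)L'/L(s, χ)`.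
[cite: MontgomeryVaughan2007, §11.3 eq. (11.22)] -/
def Faux (a : ZMod q) (s : ℂ) : ℂ := (q.totient : ℂ) * LFunctionResidueClassAux a s

omit [NeZero q] in
/-- `Λ_{q,a} ≥ 0`. [folklore] -/
theorem Lam_nonneg (a : ZMod q) (n : ℕ) : 0 ≤ Lam a n :=
  mul_nonneg (Nat.cast_nonneg _) (residueClass_nonneg a n)

omit [NeZero q] in
/-- `Λ_{q,a}(n) ≤ φ(q) Λ(n)`. [folklore] -/
theorem Lam_le (a : ZMod q) (n : ℕ) : Lam a n ≤ q.totient * ArithmeticFunction.vonMangoldt n :=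
  mul_le_mul_of_nonneg_left (residueClass_le a n) (Nat.cast_nonneg _)

omit [NeZero q] in
/-- `∑ Λ_{q,a}(n) n^{-s}` converges absolutely for `σ > 1`. [folklore] -/
theorem summable_Lam (a : ZMod q) {s : ℂ} (hs : 1 < s.re) :
    LSeriesSummable (fun n ↦ (Lam a n : ℂ)) s := by
  have h1 : LSeriesSummable (fun n ↦ (residueClass a n : ℂ)) s :=
    LSeriesSummable_of_abscissaOfAbsConv_lt_re
      ((abscissaOfAbsConv_residueClass_le_one a).trans_lt (by exact_mod_cast hs))
  refine (LSeriesSummable_congr s fun {n} _ ↦ ?_).1 (h1.smul (q.totient : ℂ))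
  simp only [Pi.smul_apply, smul_eq_mul, Lam]
  push_cast
  ring

/-- **MV (11.22)**: for `(a, q) = 1` and `σ > 1`, `∑ Λ_{q,a}(n) n^{-s} = 1/(s − 1) + F_{q,a}(s)`.
[cite: MontgomeryVaughan2007, §11.3 eq. (11.22)] -/
theorem LSeries_Lam_eq {a : ZMod q} (ha : IsUnit a) {s : ℂ} (hs : 1 < s.re) :
    LSeries (fun n ↦ (Lam a n : ℂ)) s = 1 / (s - 1) + Faux a s := by
  have hφ : (q.totient : ℂ) ≠ 0 := by exact_mod_cast (Nat.totient_pos.2 (NeZero.pos q)).ne'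
  have hAux := eqOn_LFunctionResidueClassAux ha hs
  have hsm : LSeries (fun n ↦ (Lam a n : ℂ)) s =
      (q.totient : ℂ) * LSeries (fun n ↦ (residueClass a n : ℂ)) s := by
    rw [← LSeries_smul]
    refine LSeries_congr (fun {n} _ ↦ ?_) s
    simp only [Pi.smul_apply, smul_eq_mul, Lam]
    push_cast
    ring
  rw [hsm, Faux]
  simp only at hAux
  rw [hAux]
  have hs1 : s - 1 ≠ 0 := by
    intro h; rw [sub_eq_zero] at h; rw [h] at hs; simp at hs
  field_simp
  ring

/-! ### The hypothesis "no zeros of `∏_χ L(s, χ)` in `σ > σ₁`" -/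

/-- `B_q ≤ σ₁`: every zero of every `L(s, χ)`, `χ` mod `q`, in the strip `0 < σ < 1` has real
part `≤ σ₁`. (Literally `Literature.Barriers.Parity.ZerosRealPartLE q σ₁` of the barrier catalogue
`GoldbachAverageZeros.lean`, restated to keep the import direction.)
[cite: BhowmikHalupczokMatsumotoSuzuki2019, §1 (definition of `B_q`)] -/
def ZerosRealPartLE (q : ℕ) [NeZero q] (σ₁ : ℝ) : Prop :=
  ∀ χ : DirichletCharacter ℂ q, ∀ s : ℂ, χ.LFunction s = 0 → 0 < s.re → s.re < 1 → s.re ≤ σ₁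

/-- Under `ZerosRealPartLE q σ₁` with `σ₁ ≥ 1/2`: no `L(s, χ)` vanishes at `s ≠ 1` with
`Re s > σ₁` (for `Re s ≥ 1` this is Mathlib's non-vanishing). [folklore] -/
theorem LFunction_ne_zero_of_lt_re {σ₁ : ℝ} (hσ₁ : 1 / 2 ≤ σ₁) (hZ : ZerosRealPartLE q σ₁)
    {s : ℂ} (hs : σ₁ < s.re) (hs1 : s ≠ 1) (χ : DirichletCharacter ℂ q) : χ.LFunction s ≠ 0 := by
  intro h
  rcases le_or_gt 1 s.re with h1 | h1
  · exact DirichletCharacter.LFunction_ne_zero_of_one_le_re χ (.inr hs1) h1 h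
  · have := hZ χ s h (by linarith) h1
    linarith

/-- Under `ZerosRealPartLE q σ₁`, `σ₁ ≥ 1/2`: `F_{q,a}` is holomorphic on `σ > σ₁` (including at
`s = 1`). [folklore] -/
theorem differentiableAt_Faux {σ₁ : ℝ} (hσ₁ : 1 / 2 ≤ σ₁) (hZ : ZerosRealPartLE q σ₁)
    (a : ZMod q) {s : ℂ} (hs : σ₁ < s.re) : DifferentiableAt ℂ (Faux a) s := by
  have h : s = 1 ∨ ∀ χ : DirichletCharacter ℂ q, χ.LFunction s ≠ 0 := by
    rcases eq_or_ne s 1 with h1 | h1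
    · exact Or.inl h1
    · exact Or.inr (LFunction_ne_zero_of_lt_re hσ₁ hZ hs h1)
  exact DirichletSegments.differentiableAt_Faux a h

/-- **`|F_{q,a}| ≪ φ(q)(1 + 1/ε) ℒ` to the right of the zeros.** There is an absolute `C` such that
for all `q`, `a mod q`, `1/2 ≤ σ₁`, under `ZerosRealPartLE q σ₁`, for `0 < ε` and every `s ≠ 1`
with `σ₁ + ε ≤ Re s ≤ 2`: `‖F_{q,a}(s)‖ ≤ C φ(q) (1 + 1/ε)(log q + log(|Im s| + 4))` (every zero of
the local partial fraction has `Re ρ ≤ σ₁`, hence lies at distance `≥ ε` from `s`).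
[cite: MontgomeryVaughan2007, Lemma 12.6] -/
theorem norm_Faux_le :
    ∃ C : ℝ, 0 < C ∧ ∀ (q : ℕ) [NeZero q] (a : ZMod q) (σ₁ : ℝ), 1 / 2 ≤ σ₁ →
      ZerosRealPartLE q σ₁ → ∀ ε : ℝ, 0 < ε → ∀ s : ℂ, σ₁ + ε ≤ s.re → s.re ≤ 2 → s ≠ 1 →
        ‖Faux a s‖ ≤ C * q.totient * (1 + 1 / ε) * (Real.log q + Real.log (|s.im| + 4)) := by
  obtain ⟨C, hC0, hC⟩ := DirichletSegments.exists_package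
  refine ⟨C, hC0, fun q _ a σ₁ hσ₁ hZ ε hε s hsre hs2 hs1 ↦ ?_⟩
  obtain ⟨Z, w, hZprop, -, -, hiv⟩ := hC q a s.im
  have hsσ₁ : σ₁ < s.re := by linarith
  have hmem : s ∈ closedBall (2 + (s.im : ℂ) * I) (38 / 25) := by
    have h := DirichletDisc.mem_closedBall_of_re_mem_Icc (σ := s.re) (t := s.im) (t' := s.im)
      ⟨by linarith, hs2⟩ (by simp)
    rwa [re_add_im] at h
  have hL : ∀ χ : DirichletCharacter ℂ q, χ.LFunction s ≠ 0 :=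
    LFunction_ne_zero_of_lt_re hσ₁ hZ hsσ₁ hs1
  have hdist : ∀ ρ ∈ Z, ε ≤ ‖s - ρ‖ := by
    intro ρ hρ
    obtain ⟨⟨χ, hχ⟩, hre0, hre1, -⟩ := hZprop ρ hρ
    have hρ₁ : ρ.re ≤ σ₁ := hZ χ ρ hχ (by linarith) hre1
    calc ε ≤ s.re - ρ.re := by linarith
      _ = (s - ρ).re := by simp
      _ ≤ ‖s - ρ‖ := re_le_norm _
  exact hiv s hmem hs1 hL ε hε hdist

/-! ### The Perron integrand and its integrability on `Re s = σ`, `σ₁ < σ ≤ 2` -/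

/-- `log q + log(|t| + 4) ≤ 5 (log q + 1)(1 + |t|)^{1/2}` (`log(|t|+4) ≤ 5|t|^{1/2}` for `|t| ≥ 1`,
`≤ log 5 ≤ 5` for `|t| ≤ 1`). [folklore] -/
theorem ell_le_mul_rpow (q : ℕ) (t : ℝ) :
    Real.log q + Real.log (|t| + 4) ≤ 5 * (Real.log q + 1) * (1 + |t|) ^ (1 / 2 : ℝ) := by
  have hlogq : 0 ≤ Real.log q := Real.log_natCast_nonneg q
  have h1t : 1 ≤ (1 + |t|) ^ (1 / 2 : ℝ) := Real.one_le_rpow (by linarith [abs_nonneg t]) (by norm_num)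
  have hlog4 : 1 ≤ Real.log (|t| + 4) := ClassicalZFRData.one_le_log_tau t
  -- `log(|t|+4) ≤ 5 (1+|t|)^{1/2}`
  have hmain : Real.log (|t| + 4) ≤ 5 * (1 + |t|) ^ (1 / 2 : ℝ) := by
    rcases le_or_gt 1 |t| with ht | ht
    · calc Real.log (|t| + 4) ≤ 5 * |t| ^ (1 / 2 : ℝ) := ClassicalPsiData.log_tau_le_rpow ht
        _ ≤ 5 * (1 + |t|) ^ (1 / 2 : ℝ) := by
            gcongr
            linarith
    · have h5 : Real.log (|t| + 4) ≤ Real.log 5 := Real.log_le_log (by positivity) (by linarith)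
      have hl5 : Real.log 5 ≤ 5 := by
        have := Real.log_le_sub_one_of_pos (show (0 : ℝ) < 5 by norm_num)
        linarith
      nlinarith
  calc Real.log q + Real.log (|t| + 4)
      ≤ Real.log q * Real.log (|t| + 4) + Real.log (|t| + 4) := by nlinarith
    _ = (Real.log q + 1) * Real.log (|t| + 4) := by ring
    _ ≤ (Real.log q + 1) * (5 * (1 + |t|) ^ (1 / 2 : ℝ)) :=
        mul_le_mul_of_nonneg_left hmain (by linarith)
    _ = 5 * (Real.log q + 1) * (1 + |t|) ^ (1 / 2 : ℝ) := by ring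

/-- `4/(1 + t²) · (1 + |t|)^{1/2} ≤ 8 (1 + |t|)^{-3/2}`. [folklore] -/
theorem kernel_weight_le (t : ℝ) :
    4 * (1 + t ^ 2)⁻¹ * (1 + |t|) ^ (1 / 2 : ℝ) ≤ 8 * (1 + |t|) ^ (-(3 / 2 : ℝ)) := by
  have h0 : 0 < 1 + |t| := by linarith [abs_nonneg t]
  have hsq : (1 + |t|) ^ 2 ≤ 2 * (1 + t ^ 2) := by
    have : |t| ^ 2 = t ^ 2 := sq_abs t
    nlinarith [sq_nonneg (|t| - 1)]
  have h1 : 4 * (1 + t ^ 2)⁻¹ ≤ 8 * ((1 + |t|) ^ 2)⁻¹ := by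
    have h := div_le_div_of_nonneg_left (by norm_num : (0 : ℝ) ≤ 4)
      (by positivity : (0 : ℝ) < (1 + |t|) ^ 2 / 2) (by linarith : (1 + |t|) ^ 2 / 2 ≤ 1 + t ^ 2)
    calc 4 * (1 + t ^ 2)⁻¹ = 4 / (1 + t ^ 2) := by rw [div_eq_mul_inv]
      _ ≤ 4 / ((1 + |t|) ^ 2 / 2) := h
      _ = 8 * ((1 + |t|) ^ 2)⁻¹ := by rw [div_div_eq_mul_div]; ring
  have h2 : ((1 + |t|) ^ 2)⁻¹ * (1 + |t|) ^ (1 / 2 : ℝ) = (1 + |t|) ^ (-(3 / 2 : ℝ)) := by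
    rw [show ((1 + |t|) ^ 2)⁻¹ = (1 + |t|) ^ (-(2 : ℝ)) by
      rw [Real.rpow_neg h0.le, Real.rpow_two], ← Real.rpow_add h0]
    norm_num
  calc 4 * (1 + t ^ 2)⁻¹ * (1 + |t|) ^ (1 / 2 : ℝ)
      ≤ 8 * ((1 + |t|) ^ 2)⁻¹ * (1 + |t|) ^ (1 / 2 : ℝ) :=
        mul_le_mul_of_nonneg_right h1 (by positivity)
    _ = 8 * (1 + |t|) ^ (-(3 / 2 : ℝ)) := by rw [mul_assoc, h2]

/-- `t ↦ (1 + |t|)^{-3/2}` is integrable on `ℝ`. [folklore] -/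
theorem integrable_one_add_abs_rpow : Integrable fun t : ℝ ↦ (1 + |t|) ^ (-(3 / 2 : ℝ)) := by
  have h := integrable_one_add_norm (E := ℝ) (μ := volume) (r := 3 / 2) (by simp; norm_num)
  simpa only [Real.norm_eq_abs] using h

/-- The Perron integrand `Φ_x(s) = x^{1+s} F_{q,a}(s)/(s(s+1))` is continuous along every line
`Re s = σ > σ₁` (under `ZerosRealPartLE q σ₁`, `σ₁ ≥ 1/2`). [folklore] -/
theorem continuous_Phi_line {σ₁ : ℝ} (hσ₁ : 1 / 2 ≤ σ₁) (hZ : ZerosRealPartLE q σ₁) (a : ZMod q)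
    {x : ℝ} (hx : 0 < x) {σ : ℝ} (hσ : σ₁ < σ) :
    Continuous fun t : ℝ ↦ ClassicalPsiData.Phi (Faux a) x (σ + t * I) := by
  refine continuous_iff_continuousAt.2 fun t ↦ ?_
  have hd : DifferentiableAt ℂ (ClassicalPsiData.Phi (Faux a) x) (σ + t * I) :=
    ClassicalPsiData.differentiableAt_Phi hx (differentiableAt_Faux hσ₁ hZ a (by simpa using hσ))
      (by simp; linarith)
  exact hd.continuousAt.comp (f := fun t : ℝ ↦ ((σ : ℂ) + t * I)) (by fun_prop)

/-- **Integrability of the Perron integrand on `Re s = σ`, `σ₁ + ε ≤ σ ≤ 2`** (under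
`ZerosRealPartLE q σ₁`, `σ₁ ≥ 1/2`), with the explicit majorant
`‖Φ_x(σ + it)‖ ≤ 40 C φ(q)(1 + 1/ε)(log q + 1) x^{1+σ} (1 + |t|)^{-3/2}` off `t = 0`.
[cite: MontgomeryVaughan2007, §5.1 (5.19)] -/
theorem integrable_Phi {σ₁ : ℝ} (hσ₁ : 1 / 2 ≤ σ₁) (hZ : ZerosRealPartLE q σ₁) (a : ZMod q)
    {x : ℝ} (hx : 0 < x) {ε σ : ℝ} (hε : 0 < ε) (hσ : σ₁ + ε ≤ σ) (hσ2 : σ ≤ 2) :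
    Integrable fun t : ℝ ↦ ClassicalPsiData.Phi (Faux a) x (σ + t * I) := by
  obtain ⟨C, hC0, hC⟩ := norm_Faux_le
  have hσ₁σ : σ₁ < σ := by linarith
  set K : ℝ := x ^ (1 + σ) * (C * q.totient * (1 + 1 / ε) * (5 * (Real.log q + 1))) * 8 with hK
  refine (integrable_one_add_abs_rpow.const_mul K).mono'
    (continuous_Phi_line hσ₁ hZ a hx hσ₁σ).aestronglyMeasurable ?_
  -- the bound holds for `t ≠ 0` (at `t = 0` the point `s = σ` might be the pole `s = 1`)
  have hae : ∀ᵐ t : ℝ, t ≠ (0 : ℝ) := by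
    have : ({0}ᶜ : Set ℝ) ∈ ae (volume : Measure ℝ) := by
      rw [compl_mem_ae_iff, Real.volume_singleton]
    exact this
  filter_upwards [hae] with t ht
  have hs1 : (σ : ℂ) + t * I ≠ 1 := by
    intro h
    have := congrArg Complex.im h
    simp at this
    exact ht this
  have hF := hC q a σ₁ hσ₁ hZ ε hε (σ + t * I) (by simpa using hσ) (by simpa using hσ2) hs1
  simp only [add_im, ofReal_im, mul_im, ofReal_re, I_im, mul_one, I_re, mul_zero, add_zero,
    zero_add] at hF
  have hlogq : 0 ≤ Real.log q := Real.log_natCast_nonneg q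
  have hφ0 : (0 : ℝ) ≤ q.totient := Nat.cast_nonneg _
  have hker := ClassicalPsiData.norm_kernel_le_four_div (σ := σ) (by linarith) t
  rw [ClassicalPsiData.norm_Phi_eq _ hx]
  simp only [add_re, ofReal_re, mul_re, I_re, mul_zero, ofReal_im, I_im, mul_one, sub_self,
    add_zero]
  have hell := ell_le_mul_rpow q t
  have hw := kernel_weight_le t
  have hxpos : 0 < x ^ (1 + σ) := Real.rpow_pos_of_pos hx _
  calc x ^ (1 + σ) * ‖Faux a (σ + t * I)‖ * ‖ClassicalPsiData.kernel (σ + t * I)‖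
      ≤ x ^ (1 + σ) * (C * q.totient * (1 + 1 / ε) * (5 * (Real.log q + 1) * (1 + |t|) ^ (1 / 2 : ℝ))) *
          (4 * (1 + t ^ 2)⁻¹) := by
        gcongr
        exact hF.trans (mul_le_mul_of_nonneg_left hell (by positivity))
    _ = x ^ (1 + σ) * (C * q.totient * (1 + 1 / ε) * (5 * (Real.log q + 1))) *
          (4 * (1 + t ^ 2)⁻¹ * (1 + |t|) ^ (1 / 2 : ℝ)) := by ring
    _ ≤ x ^ (1 + σ) * (C * q.totient * (1 + 1 / ε) * (5 * (Real.log q + 1))) *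
          (8 * (1 + |t|) ^ (-(3 / 2 : ℝ))) := by gcongr
    _ = K * (1 + |t|) ^ (-(3 / 2 : ℝ)) := by rw [hK]; ring

/-- **Decay on the horizontal segments** `[σ', 2] + iT`, `|T| → ∞` (under `ZerosRealPartLE q σ₁`,
`σ₁ + ε ≤ σ'`): `‖Φ_x(σ + iT)‖ ≤ ε₀` for `|T|` large, uniformly in `σ ∈ [σ', 2]`. [folklore] -/
theorem decay_Phi {σ₁ : ℝ} (hσ₁ : 1 / 2 ≤ σ₁) (hZ : ZerosRealPartLE q σ₁) (a : ZMod q)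
    {x : ℝ} (hx : 1 ≤ x) {ε σ' : ℝ} (hε : 0 < ε) (hσ' : σ₁ + ε ≤ σ') :
    ∀ e : ℝ, 0 < e → ∃ T₀ : ℝ, ∀ T : ℝ, T₀ ≤ |T| → ∀ σ ∈ Icc σ' 2,
      ‖ClassicalPsiData.Phi (Faux a) x (σ + T * I)‖ ≤ e := by
  obtain ⟨C, hC0, hC⟩ := norm_Faux_le
  intro e he
  have hx0 : 0 < x := by linarith
  set K : ℝ := x ^ (3 : ℝ) * (C * q.totient * (1 + 1 / ε) * (5 * (Real.log q + 1))) * 2 with hK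
  have hlogq : 0 ≤ Real.log q := Real.log_natCast_nonneg q
  have hφ0 : (0 : ℝ) ≤ q.totient := Nat.cast_nonneg _
  have hK0 : 0 ≤ K := by rw [hK]; positivity
  refine ⟨max 1 (K / e), fun T hT σ hσ ↦ ?_⟩
  have hT1 : 1 ≤ |T| := (le_max_left _ _).trans hT
  have hTK : K / e ≤ |T| := (le_max_right _ _).trans hT
  have hT0 : T ≠ 0 := by intro h; rw [h, abs_zero] at hT1; linarith
  have hs1 : (σ : ℂ) + T * I ≠ 1 := by
    intro h
    have := congrArg Complex.im h
    simp at this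
    exact hT0 this
  have hF := hC q a σ₁ hσ₁ hZ ε hε (σ + T * I) (by simp; linarith [hσ.1]) (by simpa using hσ.2) hs1
  simp only [add_im, ofReal_im, mul_im, ofReal_re, I_im, mul_one, I_re, mul_zero, add_zero,
    zero_add] at hF
  have hker : ‖ClassicalPsiData.kernel (σ + T * I)‖ ≤ 1 / T ^ 2 := by
    have h := ClassicalPsiData.norm_kernel_le_inv_sq (s := (σ : ℂ) + T * I) (by simpa using hT0)
    simpa using h
  rw [ClassicalPsiData.norm_Phi_eq _ hx0]
  simp only [add_re, ofReal_re, mul_re, I_re, mul_zero, ofReal_im, I_im, mul_one, sub_self,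
    add_zero]
  have hell := ell_le_mul_rpow q T
  have hxσ : x ^ (1 + σ) ≤ x ^ (3 : ℝ) := Real.rpow_le_rpow_of_exponent_le hx (by linarith [hσ.2])
  -- `(1+|T|)^{1/2} ≤ 2 |T|` and `1/T² ≤ 1/|T|`
  have hr : (1 + |T|) ^ (1 / 2 : ℝ) ≤ 1 + |T| := by
    have h1 : (1 : ℝ) ≤ 1 + |T| := by linarith
    calc (1 + |T|) ^ (1 / 2 : ℝ) ≤ (1 + |T|) ^ (1 : ℝ) :=
          Real.rpow_le_rpow_of_exponent_le h1 (by norm_num)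
      _ = 1 + |T| := Real.rpow_one _
  have hTsq : T ^ 2 = |T| ^ 2 := (sq_abs T).symm
  calc x ^ (1 + σ) * ‖Faux a (σ + T * I)‖ * ‖ClassicalPsiData.kernel (σ + T * I)‖
      ≤ x ^ (3 : ℝ) * (C * q.totient * (1 + 1 / ε) * (5 * (Real.log q + 1) * (1 + |T|) ^ (1 / 2 : ℝ))) *
          (1 / T ^ 2) := by
        gcongr
        exact hF.trans (mul_le_mul_of_nonneg_left hell (by positivity))
    _ ≤ x ^ (3 : ℝ) * (C * q.totient * (1 + 1 / ε) * (5 * (Real.log q + 1) * (2 * |T|))) *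
          (1 / T ^ 2) := by
        gcongr
        linarith
    _ = K * (|T| / T ^ 2) := by rw [hK]; ring
    _ = K / |T| := by
        have hTne : |T| ≠ 0 := abs_ne_zero.2 hT0
        rw [hTsq]
        field_simp
    _ ≤ e := by
        rw [div_le_iff₀ (by positivity)]
        rw [div_le_iff₀ he] at hTK
        linarith [mul_comm e |T|]

/-! ### Perron's formula on `Re s = 2` and the shift to `Re s = σ'` -/

/-- **Perron's formula of order one for `Λ_{q,a}`, main term removed, on `Re s = 2`**: for `x ≥ 1`,
`ψ₁(x; Λ_{q,a}) − (x − 1)²/2 = (1/2π) ∫ x^{1+s} F_{q,a}(s) dt/(s(s+1))`, `s = 2 + it`.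
[cite: MontgomeryVaughan2007, §5.1 (5.19)] -/
theorem rieszMean_sub_eq_integral_two {a : ZMod q} (ha : IsUnit a) {x : ℝ} (hx : 1 ≤ x) :
    ((ClassicalPsiData.rieszMean (Lam a) x - (x - 1) ^ 2 / 2 : ℝ) : ℂ) =
      (1 / (2 * π) : ℂ) * ∫ t : ℝ, ClassicalPsiData.Phi (Faux a) x (2 + t * I) := by
  have hx0 : 0 < x := by linarith
  have hs : LSeriesSummable (fun n ↦ (Lam a n : ℂ)) ((2 : ℝ) : ℂ) := summable_Lam a (by simp)
  have h1 := RieszMean.sum_mul_sub_eq_integral_LSeries_real (Lam a) hx0 (by norm_num : (0 : ℝ) < 2) hs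
  have h2 := RieszMean.integral_mainTerm hx (by norm_num : (1 : ℝ) < 2)
  push_cast at h2 ⊢
  rw [ClassicalPsiData.rieszMean, h1, ← h2, ← mul_sub, ← integral_sub]
  · congr 1
    refine integral_congr_ae (Eventually.of_forall fun t ↦ ?_)
    simp only [ClassicalPsiData.Phi, ClassicalPsiData.kernel]
    have hre : 1 < ((2 : ℝ) + t * I : ℂ).re := by simp
    rw [show ((2 : ℝ) : ℂ) = 2 by norm_num] at hre ⊢
    rw [LSeries_Lam_eq ha hre]
    ring
  · have := ClassicalPsiData.integrable_cpow_mul_LSeries_mul_kernel _ hx0 (by norm_num : (0:ℝ) < 2) hs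
    simpa [ClassicalPsiData.kernel] using this
  · have := ClassicalPsiData.integrable_cpow_mul_polar_mul_kernel hx0 (by norm_num : (1:ℝ) < 2)
    simpa [ClassicalPsiData.kernel] using this

/-- **The Riesz mean of `Λ_{q,a}` on the line `Re s = σ'`, `σ₁ < σ' ≤ 2`.** Under
`ZerosRealPartLE q σ₁` with `σ₁ ≥ 1/2`, for `(a, q) = 1` and `x ≥ 1`:
`ψ₁(x; Λ_{q,a}) − (x − 1)²/2 = (1/2π) ∫_{−∞}^{∞} x^{1+s} F_{q,a}(s) dt/(s(s+1))`, `s = σ' + it`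
(Perron on `Re s = 2`, then Cauchy's theorem on `[σ', 2] × [−T, T]`, `T → ∞`: `F_{q,a}` has no
singularity on `σ > σ₁`). [cite: MontgomeryVaughan2007, §5.1 (5.19) and Lemma 12.6] -/
theorem rieszMean_sub_eq_integral {a : ZMod q} (ha : IsUnit a) {σ₁ : ℝ} (hσ₁ : 1 / 2 ≤ σ₁)
    (hZ : ZerosRealPartLE q σ₁) {σ' : ℝ} (hσ' : σ₁ < σ') (hσ'2 : σ' ≤ 2) {x : ℝ} (hx : 1 ≤ x) :
    ((ClassicalPsiData.rieszMean (Lam a) x - (x - 1) ^ 2 / 2 : ℝ) : ℂ) =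
      (1 / (2 * π) : ℂ) * ∫ t : ℝ, ClassicalPsiData.Phi (Faux a) x (σ' + t * I) := by
  have hx0 : 0 < x := by linarith
  set ε : ℝ := σ' - σ₁ with hεdef
  have hε : 0 < ε := by rw [hεdef]; linarith
  have hshift := Literature.Analysis.Complex.integral_vertical_eq_of_differentiableOn
    (F := ClassicalPsiData.Phi (Faux a) x) (a := σ') (b := 2) hσ'2 ?_
    (integrable_Phi hσ₁ hZ a hx0 hε (by rw [hεdef]; linarith) hσ'2)
    (integrable_Phi hσ₁ hZ a hx0 hε (σ := 2) (by rw [hεdef]; linarith) le_rfl)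
    (decay_Phi hσ₁ hZ a hx hε (by rw [hεdef]; linarith))
  · push_cast at hshift
    rw [rieszMean_sub_eq_integral_two ha hx, ← hshift]
  · intro s hs
    have hre : σ' ≤ s.re := hs.1
    exact (ClassicalPsiData.differentiableAt_Phi hx0
      (differentiableAt_Faux hσ₁ hZ a (by linarith)) (by linarith)).differentiableWithinAt

end Literature.NumberTheory.LFunctions.ResidueRiesz

end
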